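import Mathlib
import HarnessLib
import Summits.Ventures.LatticeQCDFlow.Exactness.SUNJitteredHMCCertificates
import Summits.Ventures.LatticeQCDFlow.Exactness.SUNMetropolisORSweepFiguresOfMerit
import Summits.Ventures.LatticeQCDFlow.Exactness.CabibboMarinariORSweepFiguresOfMerit
import Summits.Ventures.LatticeQCDFlow.Exactness.SUNLeapfrogHMCORSweepFiguresOfMerit
import Summits.Ventures.LatticeQCDFlow.Exactness.NCMCGeneralSpaceTauIntWindowConsistency

/-!
# The PRINTED Γ-method `τ̂_int,W` is consistent for the engine's chains as run (GEN-23, row 9 eng-latcore, 23-16)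

NEW WORK of the cell, not a published result; no definition is introduced; nothing is cited as a fact.
HONEST FRAMING: exact (Metropolis-corrected) sampling algorithms for lattice gauge theory; figures of merit are
autocorrelation/cost numbers at stated couplings and volumes; no continuum-physics claim.

What scorer A PRINTS for a stream `y_i = f(U_i)` of an engine chain is the Madras–Sokal / Wolff windowed
`tau_int_W = Scoring.tauIntWindow (Scoring.rhoHat y N) W = 1/2 + Σ_{t=1}^{W} ρ̂_N(t)` at a window `W = W_N`
(row 11's typing `Scoring/SampleACFSumZero`, `Scoring/CalibrationTruths`).  `NCMCGeneralSpaceTauIntWindowConsistency` says: for ANY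
Markov kernel `K` with an invariant probability `π` and a Doeblin power `ε • ν ≤ K^m(z, ·)` (`ε ≠ 0`, `0 < m`), from
EVERY initial law `μ₀`, at deterministic windows `W_N → ∞` with `W_N³/N → 0`, for every bounded measurable `f` with
`Var_π f > 0`: the printed `τ̂_{N,W_N} → τ_f := σ²_f/(2 C_f̄(0))` in `P_{μ₀}`-probability (`σ²_f` the Green–Kubo
variance, `C_f̄` the stationary autocovariance of the centred `f`); every lag estimate `Γ̂_N(t) → C_f̄(t)`; and for
the indicator of an event `A` with `0 < π(A) < 1` the limit IS the FITNESS `Scoring.tauInt (setACF K π A)`.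

THIS FILE applies it to the Doeblin CERTIFICATES of GEN-23 (`SUNJitteredHMCCertificates`,
`SUNLeapfrogHMCORSweepFiguresOfMerit`, `SUNMetropolisORSweepFiguresOfMerit`, `CabibboMarinariORSweepFiguresOfMerit`),
i.e. to the engine's update paths AS RUN on `SU(N)`, `L ≥ 2` where a sweep is involved, any `β`:

* §1 the jittered `'hmc'` path `wilsonJitterHMC N d L β nstep τ η` whenever ONE atom `l₀` of the jitter law is short
  (`η {l₀} ≠ 0`, `1 ≤ nstep l₀`, `0 < τ l₀ ≤ τ₀(N, d, L, β)`): **`wilsonJitterHMC_gammaHat_tendstoInMeasure`** (every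
  lag), **`wilsonJitterHMC_tauIntWindow_tendstoInMeasure`** (the printed `τ̂ → τ_f`),
  **`wilsonJitterHMC_tauIntWindow_indicator_tendstoInMeasure`** (event indicators: `τ̂ →` the FITNESS `τ_int`);
* §2 the same followed by ANY exact step `P` (e.g. `n_or ×` Cabibbo–Marinari `'or'`):
  **`wilsonJitterHMC_exactStep_tauIntWindow_tendstoInMeasure`**, **`…_indicator_…`**;
* §3 the DEFAULT fixed-step `'hmc'` (`nstep · ε ≤ τ₀`) followed by ANY exact step:
  **`wilson_sunLeapfrogHMCN_exactStep_tauIntWindow_tendstoInMeasure`**;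
* §4 `'metro'` (`nhit ≥ 1` SU(2)-subgroup Metropolis hits on every link) `+ n_or × 'or'`:
  **`wilson_sunMetropolis_orSweep_tauIntWindow_tendstoInMeasure`**, **`…_indicator_…`**;
* §5 `'hb'` (Cabibbo–Marinari heat-bath sweep, lexicographic subgroup order or its reverse) `+ n_or × 'or'`:
  **`wilson_cmSweep_orSweep_tauIntWindow_tendstoInMeasure`**, **`…_indicator_…`**.

NOT CLAIMED: the scorer's automatic window (`Scoring/ChainMadrasSokalDataWindow`); a.s. consistency; a rate; values.
-/

noncomputable section

namespace Summit.Ventures.LatticeQCDFlow.Exactness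

open MeasureTheory ProbabilityTheory ProbabilityTheory.Kernel Set Function Filter Topology
open Literature.MathematicalPhysics.QuantumFieldTheory
open Literature.MathematicalPhysics.QuantumLattice (fundamentalRep continuous_fundamentalRep connectedSpace_specialUnitaryGroup)
open Summit.Ventures.LatticeQCDFlow.Scoring (tauInt autocov rhoHat gammaHat tauIntWindow)
open scoped ENNReal Matrix Matrix.Norms.Operator NNReal

/-! ## §1 The jittered `'hmc'` path with one short atom -/

section Jittered

variable {N d L : ℕ} [NeZero N] [NeZero L] (β : ℝ)
variable {Lab : Type*} [Countable Lab] [MeasurableSpace Lab] [MeasurableSingletonClass Lab]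

/-- **EVERY LAG ESTIMATE OF THE JITTERED ENGINE HMC IS CONSISTENT, FROM EVERY START**: there is `τ₀ > 0` (depending
on `N, d, L, β` only) such that whenever one atom `l₀` of the jitter law has `1 ≤ nstep l₀`, `η {l₀} ≠ 0`,
`0 < τ l₀ ≤ τ₀`, for every bounded measurable `f`, every lag `t` and every initial law `μ₀`,
`Γ̂_N(t) → C_f̄(t)` in `P_{μ₀}`-probability. -/
theorem wilsonJitterHMC_gammaHat_tendstoInMeasure :
    ∃ τ₀ : ℝ, 0 < τ₀ ∧ ∀ (nstep : Lab → ℕ) (τ : Lab → ℝ) (η : Measure Lab) [IsProbabilityMeasure η] (l₀ : Lab),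
      1 ≤ nstep l₀ → η {l₀} ≠ 0 → 0 < τ l₀ → τ l₀ ≤ τ₀ →
      ∀ (f : GaugeConfig d L (Matrix.specialUnitaryGroup (Fin N) ℂ) → ℝ), Measurable f → ∀ C : ℝ, (∀ U, |f U| ≤ C) →
      ∀ (t : ℕ) (μ₀ : Measure (GaugeConfig d L (Matrix.specialUnitaryGroup (Fin N) ℂ))) [IsProbabilityMeasure μ₀],
        TendstoInMeasure (Kernel.trajMeasure (X := fun _ : ℕ => GaugeConfig d L (Matrix.specialUnitaryGroup (Fin N) ℂ)) μ₀
              (fun n : ℕ => (wilsonJitterHMC N d L β nstep τ η).comap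
                (fun h : (i : ↥(Finset.Iic n)) → GaugeConfig d L (Matrix.specialUnitaryGroup (Fin N) ℂ) =>
                  h ⟨n, Finset.mem_Iic.2 le_rfl⟩) (measurable_pi_apply _)))
          (fun (n : ℕ) (x : ℕ → GaugeConfig d L (Matrix.specialUnitaryGroup (Fin N) ℂ)) => gammaHat (fun i => f (x i)) n t)
          atTop (fun _ => autocov (wilsonJitterHMC N d L β nstep τ η)
            (wilsonMeasure (d := d) (L := L) (fundamentalRep (Fin N)) (β / N))
            (fun y => f y - ∫ z, f z ∂(wilsonMeasure (d := d) (L := L) (fundamentalRep (Fin N)) (β / N))) t) := by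
  obtain ⟨τ₀, hτ₀, h⟩ := wilsonJitterHMC_certificate (N := N) (d := d) (L := L) (Lab := Lab) β
  refine ⟨τ₀, hτ₀, fun nstep τ η _ l₀ hn hl₀ hτl hτl₀ f hf C hC t μ₀ _ => ?_⟩
  obtain ⟨m, ε', hm, hε0, hε1, hmin⟩ := h nstep τ η l₀ hn hl₀ hτl hτl₀
  exact GeneralNCMC.chain_gammaHat_tendstoInMeasure_of_nHit μ₀
    (wilsonJitterHMC_invariant (N := N) (d := d) (L := L) β nstep τ η) hε0.ne' hmin hm hf hC t

/-- **THE PRINTED `τ̂_int,W` OF THE JITTERED ENGINE HMC IS CONSISTENT, FROM EVERY START**: same `τ₀`; for every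
bounded measurable `f` with `Var_π f > 0`, every initial law `μ₀` and every window sequence `W_N → ∞` with
`W_N³/N → 0`, `tauIntWindow (rhoHat (f ∘ U) N) (W N) → τ_f = σ²_f/(2 C_f̄(0))` in `P_{μ₀}`-probability. -/
theorem wilsonJitterHMC_tauIntWindow_tendstoInMeasure :
    ∃ τ₀ : ℝ, 0 < τ₀ ∧ ∀ (nstep : Lab → ℕ) (τ : Lab → ℝ) (η : Measure Lab) [IsProbabilityMeasure η] (l₀ : Lab),
      1 ≤ nstep l₀ → η {l₀} ≠ 0 → 0 < τ l₀ → τ l₀ ≤ τ₀ →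
      ∀ (f : GaugeConfig d L (Matrix.specialUnitaryGroup (Fin N) ℂ) → ℝ), Measurable f → ∀ C : ℝ, (∀ U, |f U| ≤ C) →
        0 < autocov (wilsonJitterHMC N d L β nstep τ η) (wilsonMeasure (d := d) (L := L) (fundamentalRep (Fin N)) (β / N))
          (fun y => f y - ∫ z, f z ∂(wilsonMeasure (d := d) (L := L) (fundamentalRep (Fin N)) (β / N))) 0 →
      ∀ (μ₀ : Measure (GaugeConfig d L (Matrix.specialUnitaryGroup (Fin N) ℂ))) [IsProbabilityMeasure μ₀] (W : ℕ → ℕ),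
        Tendsto W atTop atTop → Tendsto (fun n => (W n : ℝ) ^ 3 / n) atTop (nhds 0) →
        TendstoInMeasure (Kernel.trajMeasure (X := fun _ : ℕ => GaugeConfig d L (Matrix.specialUnitaryGroup (Fin N) ℂ)) μ₀
              (fun n : ℕ => (wilsonJitterHMC N d L β nstep τ η).comap
                (fun h : (i : ↥(Finset.Iic n)) → GaugeConfig d L (Matrix.specialUnitaryGroup (Fin N) ℂ) =>
                  h ⟨n, Finset.mem_Iic.2 le_rfl⟩) (measurable_pi_apply _)))
          (fun (n : ℕ) (x : ℕ → GaugeConfig d L (Matrix.specialUnitaryGroup (Fin N) ℂ)) =>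
            tauIntWindow (rhoHat (fun i => f (x i)) n) (W n))
          atTop (fun _ =>
            (autocov (wilsonJitterHMC N d L β nstep τ η) (wilsonMeasure (d := d) (L := L) (fundamentalRep (Fin N)) (β / N))
                (fun y => f y - ∫ z, f z ∂(wilsonMeasure (d := d) (L := L) (fundamentalRep (Fin N)) (β / N))) 0
              + 2 * ∑' t, autocov (wilsonJitterHMC N d L β nstep τ η)
                (wilsonMeasure (d := d) (L := L) (fundamentalRep (Fin N)) (β / N))
                (fun y => f y - ∫ z, f z ∂(wilsonMeasure (d := d) (L := L) (fundamentalRep (Fin N)) (β / N))) (t + 1))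
            / (2 * autocov (wilsonJitterHMC N d L β nstep τ η) (wilsonMeasure (d := d) (L := L) (fundamentalRep (Fin N)) (β / N))
                (fun y => f y - ∫ z, f z ∂(wilsonMeasure (d := d) (L := L) (fundamentalRep (Fin N)) (β / N))) 0)) := by
  obtain ⟨τ₀, hτ₀, h⟩ := wilsonJitterHMC_certificate (N := N) (d := d) (L := L) (Lab := Lab) β
  refine ⟨τ₀, hτ₀, fun nstep τ η _ l₀ hn hl₀ hτl hτl₀ f hf C hC hvar μ₀ _ W hW hW3 => ?_⟩
  obtain ⟨m, ε', hm, hε0, hε1, hmin⟩ := h nstep τ η l₀ hn hl₀ hτl hτl₀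
  exact GeneralNCMC.chain_tauIntWindow_tendstoInMeasure_of_nHit μ₀
    (wilsonJitterHMC_invariant (N := N) (d := d) (L := L) β nstep τ η) hε0.ne' hmin hm hf hC hvar hW hW3

/-- **FOR AN EVENT, THE PRINTED `τ̂_int,W` CONVERGES TO THE FITNESS `τ_int`**: same `τ₀`; for every measurable event
`A` with `0 < π(A) < 1` (a topological sector, a level set of the plaquette, …), every initial law and every window
sequence `W_N → ∞`, `W_N³/N → 0`, the printed `τ̂` of the indicator series converges in probability to
`Scoring.tauInt (setACF K π A)` — the quantity bounded by ONE constant in `SUNJitteredHMCFiguresOfMerit`. -/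
theorem wilsonJitterHMC_tauIntWindow_indicator_tendstoInMeasure :
    ∃ τ₀ : ℝ, 0 < τ₀ ∧ ∀ (nstep : Lab → ℕ) (τ : Lab → ℝ) (η : Measure Lab) [IsProbabilityMeasure η] (l₀ : Lab),
      1 ≤ nstep l₀ → η {l₀} ≠ 0 → 0 < τ l₀ → τ l₀ ≤ τ₀ →
      ∀ (A : Set (GaugeConfig d L (Matrix.specialUnitaryGroup (Fin N) ℂ))), MeasurableSet A →
        0 < (wilsonMeasure (d := d) (L := L) (fundamentalRep (Fin N)) (β / N)).real A →
        (wilsonMeasure (d := d) (L := L) (fundamentalRep (Fin N)) (β / N)).real A < 1 →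
      ∀ (μ₀ : Measure (GaugeConfig d L (Matrix.specialUnitaryGroup (Fin N) ℂ))) [IsProbabilityMeasure μ₀] (W : ℕ → ℕ),
        Tendsto W atTop atTop → Tendsto (fun n => (W n : ℝ) ^ 3 / n) atTop (nhds 0) →
        TendstoInMeasure (Kernel.trajMeasure (X := fun _ : ℕ => GaugeConfig d L (Matrix.specialUnitaryGroup (Fin N) ℂ)) μ₀
              (fun n : ℕ => (wilsonJitterHMC N d L β nstep τ η).comap
                (fun h : (i : ↥(Finset.Iic n)) → GaugeConfig d L (Matrix.specialUnitaryGroup (Fin N) ℂ) =>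
                  h ⟨n, Finset.mem_Iic.2 le_rfl⟩) (measurable_pi_apply _)))
          (fun (n : ℕ) (x : ℕ → GaugeConfig d L (Matrix.specialUnitaryGroup (Fin N) ℂ)) =>
            tauIntWindow (rhoHat (fun i => A.indicator (1 : GaugeConfig d L (Matrix.specialUnitaryGroup (Fin N) ℂ) → ℝ) (x i)) n) (W n))
          atTop (fun _ => tauInt (setACF (wilsonJitterHMC N d L β nstep τ η)
            (wilsonMeasure (d := d) (L := L) (fundamentalRep (Fin N)) (β / N)) A)) := by
  obtain ⟨τ₀, hτ₀, h⟩ := wilsonJitterHMC_certificate (N := N) (d := d) (L := L) (Lab := Lab) β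
  refine ⟨τ₀, hτ₀, fun nstep τ η _ l₀ hn hl₀ hτl hτl₀ A hA h0 h1 μ₀ _ W hW hW3 => ?_⟩
  obtain ⟨m, ε', hm, hε0, hε1, hmin⟩ := h nstep τ η l₀ hn hl₀ hτl hτl₀
  exact GeneralNCMC.chain_tauIntWindow_indicator_tendstoInMeasure_of_nHit μ₀
    (wilsonJitterHMC_invariant (N := N) (d := d) (L := L) β nstep τ η) hε0.ne' hmin hm hA h0 h1 hW hW3

/-! ## §2 The jittered `'hmc'` path followed by ANY exact step -/

/-- **THE PRINTED `τ̂_int,W` OF THE COMPOSITE `P ∘ K_jit` IS CONSISTENT, FROM EVERY START** — `P` ANY Markov kernel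
leaving `wilsonMeasure (β/N)` invariant (any schedule of Cabibbo–Marinari over-relaxation hits, heat-bath sweeps, …);
`Var_π f > 0`, `W_N → ∞`, `W_N³/N → 0`. -/
theorem wilsonJitterHMC_exactStep_tauIntWindow_tendstoInMeasure :
    ∃ τ₀ : ℝ, 0 < τ₀ ∧ ∀ (nstep : Lab → ℕ) (τ : Lab → ℝ) (η : Measure Lab) [IsProbabilityMeasure η] (l₀ : Lab),
      1 ≤ nstep l₀ → η {l₀} ≠ 0 → 0 < τ l₀ → τ l₀ ≤ τ₀ →
      ∀ (P : Kernel (GaugeConfig d L (Matrix.specialUnitaryGroup (Fin N) ℂ)) (GaugeConfig d L (Matrix.specialUnitaryGroup (Fin N) ℂ)))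
        [IsMarkovKernel P], Invariant P (wilsonMeasure (d := d) (L := L) (fundamentalRep (Fin N)) (β / N)) →
      ∀ (f : GaugeConfig d L (Matrix.specialUnitaryGroup (Fin N) ℂ) → ℝ), Measurable f → ∀ C : ℝ, (∀ U, |f U| ≤ C) →
        0 < autocov (P ∘ₖ wilsonJitterHMC N d L β nstep τ η) (wilsonMeasure (d := d) (L := L) (fundamentalRep (Fin N)) (β / N))
          (fun y => f y - ∫ z, f z ∂(wilsonMeasure (d := d) (L := L) (fundamentalRep (Fin N)) (β / N))) 0 →
      ∀ (μ₀ : Measure (GaugeConfig d L (Matrix.specialUnitaryGroup (Fin N) ℂ))) [IsProbabilityMeasure μ₀] (W : ℕ → ℕ),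
        Tendsto W atTop atTop → Tendsto (fun n => (W n : ℝ) ^ 3 / n) atTop (nhds 0) →
        TendstoInMeasure (Kernel.trajMeasure (X := fun _ : ℕ => GaugeConfig d L (Matrix.specialUnitaryGroup (Fin N) ℂ)) μ₀
              (fun n : ℕ => (P ∘ₖ wilsonJitterHMC N d L β nstep τ η).comap
                (fun h : (i : ↥(Finset.Iic n)) → GaugeConfig d L (Matrix.specialUnitaryGroup (Fin N) ℂ) =>
                  h ⟨n, Finset.mem_Iic.2 le_rfl⟩) (measurable_pi_apply _)))
          (fun (n : ℕ) (x : ℕ → GaugeConfig d L (Matrix.specialUnitaryGroup (Fin N) ℂ)) =>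
            tauIntWindow (rhoHat (fun i => f (x i)) n) (W n))
          atTop (fun _ =>
            (autocov (P ∘ₖ wilsonJitterHMC N d L β nstep τ η) (wilsonMeasure (d := d) (L := L) (fundamentalRep (Fin N)) (β / N))
                (fun y => f y - ∫ z, f z ∂(wilsonMeasure (d := d) (L := L) (fundamentalRep (Fin N)) (β / N))) 0
              + 2 * ∑' t, autocov (P ∘ₖ wilsonJitterHMC N d L β nstep τ η)
                (wilsonMeasure (d := d) (L := L) (fundamentalRep (Fin N)) (β / N))
                (fun y => f y - ∫ z, f z ∂(wilsonMeasure (d := d) (L := L) (fundamentalRep (Fin N)) (β / N))) (t + 1))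
            / (2 * autocov (P ∘ₖ wilsonJitterHMC N d L β nstep τ η) (wilsonMeasure (d := d) (L := L) (fundamentalRep (Fin N)) (β / N))
                (fun y => f y - ∫ z, f z ∂(wilsonMeasure (d := d) (L := L) (fundamentalRep (Fin N)) (β / N))) 0)) := by
  obtain ⟨τ₀, hτ₀, h⟩ := wilsonJitterHMC_exactStep_certificate (N := N) (d := d) (L := L) (Lab := Lab) β
  refine ⟨τ₀, hτ₀, fun nstep τ η _ l₀ hn hl₀ hτl hτl₀ P _ hP f hf C hC hvar μ₀ _ W hW hW3 => ?_⟩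
  obtain ⟨hinv, m, ε', hm, hε0, hε1, hmin⟩ := h nstep τ η l₀ hn hl₀ hτl hτl₀ P hP
  haveI := isMarkovKernel_wilsonJitterHMC (N := N) (d := d) (L := L) β nstep τ η
  exact GeneralNCMC.chain_tauIntWindow_tendstoInMeasure_of_nHit μ₀ hinv hε0.ne' hmin hm hf hC hvar hW hW3

/-- **FOR AN EVENT OF THE COMPOSITE `P ∘ K_jit`, THE PRINTED `τ̂` CONVERGES TO THE FITNESS `τ_int`** (`0 < π(A) < 1`,
every start, `W_N → ∞`, `W_N³/N → 0`). -/
theorem wilsonJitterHMC_exactStep_tauIntWindow_indicator_tendstoInMeasure :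
    ∃ τ₀ : ℝ, 0 < τ₀ ∧ ∀ (nstep : Lab → ℕ) (τ : Lab → ℝ) (η : Measure Lab) [IsProbabilityMeasure η] (l₀ : Lab),
      1 ≤ nstep l₀ → η {l₀} ≠ 0 → 0 < τ l₀ → τ l₀ ≤ τ₀ →
      ∀ (P : Kernel (GaugeConfig d L (Matrix.specialUnitaryGroup (Fin N) ℂ)) (GaugeConfig d L (Matrix.specialUnitaryGroup (Fin N) ℂ)))
        [IsMarkovKernel P], Invariant P (wilsonMeasure (d := d) (L := L) (fundamentalRep (Fin N)) (β / N)) →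
      ∀ (A : Set (GaugeConfig d L (Matrix.specialUnitaryGroup (Fin N) ℂ))), MeasurableSet A →
        0 < (wilsonMeasure (d := d) (L := L) (fundamentalRep (Fin N)) (β / N)).real A →
        (wilsonMeasure (d := d) (L := L) (fundamentalRep (Fin N)) (β / N)).real A < 1 →
      ∀ (μ₀ : Measure (GaugeConfig d L (Matrix.specialUnitaryGroup (Fin N) ℂ))) [IsProbabilityMeasure μ₀] (W : ℕ → ℕ),
        Tendsto W atTop atTop → Tendsto (fun n => (W n : ℝ) ^ 3 / n) atTop (nhds 0) →
        TendstoInMeasure (Kernel.trajMeasure (X := fun _ : ℕ => GaugeConfig d L (Matrix.specialUnitaryGroup (Fin N) ℂ)) μ₀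
              (fun n : ℕ => (P ∘ₖ wilsonJitterHMC N d L β nstep τ η).comap
                (fun h : (i : ↥(Finset.Iic n)) → GaugeConfig d L (Matrix.specialUnitaryGroup (Fin N) ℂ) =>
                  h ⟨n, Finset.mem_Iic.2 le_rfl⟩) (measurable_pi_apply _)))
          (fun (n : ℕ) (x : ℕ → GaugeConfig d L (Matrix.specialUnitaryGroup (Fin N) ℂ)) =>
            tauIntWindow (rhoHat (fun i => A.indicator (1 : GaugeConfig d L (Matrix.specialUnitaryGroup (Fin N) ℂ) → ℝ) (x i)) n) (W n))
          atTop (fun _ => tauInt (setACF (P ∘ₖ wilsonJitterHMC N d L β nstep τ η)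
            (wilsonMeasure (d := d) (L := L) (fundamentalRep (Fin N)) (β / N)) A)) := by
  obtain ⟨τ₀, hτ₀, h⟩ := wilsonJitterHMC_exactStep_certificate (N := N) (d := d) (L := L) (Lab := Lab) β
  refine ⟨τ₀, hτ₀, fun nstep τ η _ l₀ hn hl₀ hτl hτl₀ P _ hP A hA h0 h1 μ₀ _ W hW hW3 => ?_⟩
  obtain ⟨hinv, m, ε', hm, hε0, hε1, hmin⟩ := h nstep τ η l₀ hn hl₀ hτl hτl₀ P hP
  haveI := isMarkovKernel_wilsonJitterHMC (N := N) (d := d) (L := L) β nstep τ η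
  exact GeneralNCMC.chain_tauIntWindow_indicator_tendstoInMeasure_of_nHit μ₀ hinv hε0.ne' hmin hm hA h0 h1 hW hW3

end Jittered

/-! ## §3 The DEFAULT fixed-step `'hmc'` followed by ANY exact step -/

section FixedStep

variable (N : ℕ) [NeZero N] {d L : ℕ} [NeZero L] (β : ℝ)

/-- **THE PRINTED `τ̂_int,W` OF `P ∘ K_hmc` (FIXED STEP, `nstep · ε ≤ τ₀`) IS CONSISTENT, FROM EVERY START** — `P` ANY
exact step; `Var_π f > 0`, `W_N → ∞`, `W_N³/N → 0`. -/
theorem wilson_sunLeapfrogHMCN_exactStep_tauIntWindow_tendstoInMeasure :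
    ∃ τ₀ : ℝ, 0 < τ₀ ∧ ∀ (nstep : ℕ) (ε : ℝ), 1 ≤ nstep → 0 < ε → nstep * ε ≤ τ₀ →
      ∀ (P : Kernel (GaugeConfig d L (Matrix.specialUnitaryGroup (Fin N) ℂ)) (GaugeConfig d L (Matrix.specialUnitaryGroup (Fin N) ℂ)))
        [IsMarkovKernel P], Invariant P (wilsonMeasure (d := d) (L := L) (fundamentalRep (Fin N)) (β / N)) →
      ∀ [IsMarkovKernel (sunLeapfrogHMCN (sunCoordι N) (sunCoordι_skew N) ε (Measure.addHaar : Measure (SUNCoords N))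
                  (sunKinetic N) (measurable_halfKick_sun N (measurable_sunWilsonForceLaw_coeConfig N (d := d) (L := L) β) ε)
                  (fun U => β / N * wilsonAction (fundamentalRep (Fin N)) U) nstep)],
      ∀ (f : GaugeConfig d L (Matrix.specialUnitaryGroup (Fin N) ℂ) → ℝ), Measurable f → ∀ C : ℝ, (∀ U, |f U| ≤ C) →
        0 < autocov (P ∘ₖ (sunLeapfrogHMCN (sunCoordι N) (sunCoordι_skew N) ε (Measure.addHaar : Measure (SUNCoords N))
                  (sunKinetic N) (measurable_halfKick_sun N (measurable_sunWilsonForceLaw_coeConfig N (d := d) (L := L) β) ε)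
                  (fun U => β / N * wilsonAction (fundamentalRep (Fin N)) U) nstep))
          (wilsonMeasure (d := d) (L := L) (fundamentalRep (Fin N)) (β / N))
          (fun y => f y - ∫ z, f z ∂(wilsonMeasure (d := d) (L := L) (fundamentalRep (Fin N)) (β / N))) 0 →
      ∀ (μ₀ : Measure (GaugeConfig d L (Matrix.specialUnitaryGroup (Fin N) ℂ))) [IsProbabilityMeasure μ₀] (W : ℕ → ℕ),
        Tendsto W atTop atTop → Tendsto (fun n => (W n : ℝ) ^ 3 / n) atTop (nhds 0) →
        TendstoInMeasure (Kernel.trajMeasure (X := fun _ : ℕ => GaugeConfig d L (Matrix.specialUnitaryGroup (Fin N) ℂ)) μ₀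
              (fun n : ℕ => (P ∘ₖ (sunLeapfrogHMCN (sunCoordι N) (sunCoordι_skew N) ε (Measure.addHaar : Measure (SUNCoords N))
                  (sunKinetic N) (measurable_halfKick_sun N (measurable_sunWilsonForceLaw_coeConfig N (d := d) (L := L) β) ε)
                  (fun U => β / N * wilsonAction (fundamentalRep (Fin N)) U) nstep)).comap
                (fun h : (i : ↥(Finset.Iic n)) → GaugeConfig d L (Matrix.specialUnitaryGroup (Fin N) ℂ) =>
                  h ⟨n, Finset.mem_Iic.2 le_rfl⟩) (measurable_pi_apply _)))
          (fun (n : ℕ) (x : ℕ → GaugeConfig d L (Matrix.specialUnitaryGroup (Fin N) ℂ)) =>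
            tauIntWindow (rhoHat (fun i => f (x i)) n) (W n))
          atTop (fun _ =>
            (autocov (P ∘ₖ (sunLeapfrogHMCN (sunCoordι N) (sunCoordι_skew N) ε (Measure.addHaar : Measure (SUNCoords N))
                  (sunKinetic N) (measurable_halfKick_sun N (measurable_sunWilsonForceLaw_coeConfig N (d := d) (L := L) β) ε)
                  (fun U => β / N * wilsonAction (fundamentalRep (Fin N)) U) nstep))
                (wilsonMeasure (d := d) (L := L) (fundamentalRep (Fin N)) (β / N))
                (fun y => f y - ∫ z, f z ∂(wilsonMeasure (d := d) (L := L) (fundamentalRep (Fin N)) (β / N))) 0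
              + 2 * ∑' t, autocov (P ∘ₖ (sunLeapfrogHMCN (sunCoordι N) (sunCoordι_skew N) ε (Measure.addHaar : Measure (SUNCoords N))
                  (sunKinetic N) (measurable_halfKick_sun N (measurable_sunWilsonForceLaw_coeConfig N (d := d) (L := L) β) ε)
                  (fun U => β / N * wilsonAction (fundamentalRep (Fin N)) U) nstep))
                (wilsonMeasure (d := d) (L := L) (fundamentalRep (Fin N)) (β / N))
                (fun y => f y - ∫ z, f z ∂(wilsonMeasure (d := d) (L := L) (fundamentalRep (Fin N)) (β / N))) (t + 1))
            / (2 * autocov (P ∘ₖ (sunLeapfrogHMCN (sunCoordι N) (sunCoordι_skew N) ε (Measure.addHaar : Measure (SUNCoords N))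
                  (sunKinetic N) (measurable_halfKick_sun N (measurable_sunWilsonForceLaw_coeConfig N (d := d) (L := L) β) ε)
                  (fun U => β / N * wilsonAction (fundamentalRep (Fin N)) U) nstep))
                (wilsonMeasure (d := d) (L := L) (fundamentalRep (Fin N)) (β / N))
                (fun y => f y - ∫ z, f z ∂(wilsonMeasure (d := d) (L := L) (fundamentalRep (Fin N)) (β / N))) 0)) := by
  obtain ⟨τ₀, hτ₀, h⟩ := wilson_sunLeapfrogHMCN_exactStep_certificate N (d := d) (L := L) β
  refine ⟨τ₀, hτ₀, fun nstep ε hn hε hτ P _ hP _ f hf C hC hvar μ₀ _ W hW hW3 => ?_⟩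
  obtain ⟨hinv, m, ε', hm, hε0, hε1, hmin⟩ := h nstep ε hn hε hτ P hP
  exact GeneralNCMC.chain_tauIntWindow_tendstoInMeasure_of_nHit μ₀ hinv hε0.ne' hmin hm hf hC hvar hW hW3

end FixedStep

/-! ## §4 `'metro' + n_or × 'or'` -/

section MetroOR

variable (N : ℕ) (s : ℝ) [Fact (0 < s)] [NeZero N]
variable {d L : ℕ} {m : Type*} [Fintype m] [DecidableEq m]

/-- **THE PRINTED `τ̂_int,W` OF `'metro' + n_or × 'or'` IS CONSISTENT, FROM EVERY START** (`L ≥ 2`, `nhit ≥ 1`, the link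
list visits every link, any OR schedule; `Var_π f > 0`, `W_N → ∞`, `W_N³/N → 0`). -/
theorem wilson_sunMetropolis_orSweep_tauIntWindow_tendstoInMeasure [NeZero L] (hL : 2 ≤ L) (β : ℝ) {nhit : ℕ} (hn : 1 ≤ nhit)
    {Ls : List (Edge d L)} (hLs : ∀ e, e ∈ Ls) (sched : List (Edge d L × (Fin N ≃ Fin 2 ⊕ m)))
    [IsMarkovKernel (metropolisSweep (sunMetropolisKick N s)
                (fun U : GaugeConfig d L (Matrix.specialUnitaryGroup (Fin N) ℂ) => Real.exp (-β * wilsonAction (suRep N) U)) nhit Ls)]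
    {f : GaugeConfig d L (Matrix.specialUnitaryGroup (Fin N) ℂ) → ℝ} (hf : Measurable f) {C : ℝ} (hC : ∀ U, |f U| ≤ C)
    (hvar : 0 < autocov (cmORSweep sched ∘ₖ metropolisSweep (sunMetropolisKick N s)
                (fun U : GaugeConfig d L (Matrix.specialUnitaryGroup (Fin N) ℂ) => Real.exp (-β * wilsonAction (suRep N) U)) nhit Ls)
        (wilsonMeasure (d := d) (L := L) (suRep N) β) (fun y => f y - ∫ z, f z ∂(wilsonMeasure (d := d) (L := L) (suRep N) β)) 0)
    (μ₀ : Measure (GaugeConfig d L (Matrix.specialUnitaryGroup (Fin N) ℂ))) [IsProbabilityMeasure μ₀]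
    {W : ℕ → ℕ} (hW : Tendsto W atTop atTop) (hW3 : Tendsto (fun n => (W n : ℝ) ^ 3 / n) atTop (nhds 0)) :
    TendstoInMeasure (Kernel.trajMeasure (X := fun _ : ℕ => GaugeConfig d L (Matrix.specialUnitaryGroup (Fin N) ℂ)) μ₀
              (fun n : ℕ => (cmORSweep sched ∘ₖ metropolisSweep (sunMetropolisKick N s)
                (fun U : GaugeConfig d L (Matrix.specialUnitaryGroup (Fin N) ℂ) => Real.exp (-β * wilsonAction (suRep N) U)) nhit Ls).comap
                (fun h : (i : ↥(Finset.Iic n)) → GaugeConfig d L (Matrix.specialUnitaryGroup (Fin N) ℂ) =>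
                  h ⟨n, Finset.mem_Iic.2 le_rfl⟩) (measurable_pi_apply _)))
      (fun (n : ℕ) (x : ℕ → GaugeConfig d L (Matrix.specialUnitaryGroup (Fin N) ℂ)) =>
        tauIntWindow (rhoHat (fun i => f (x i)) n) (W n))
      atTop (fun _ =>
        (autocov (cmORSweep sched ∘ₖ metropolisSweep (sunMetropolisKick N s)
                (fun U : GaugeConfig d L (Matrix.specialUnitaryGroup (Fin N) ℂ) => Real.exp (-β * wilsonAction (suRep N) U)) nhit Ls)
            (wilsonMeasure (d := d) (L := L) (suRep N) β) (fun y => f y - ∫ z, f z ∂(wilsonMeasure (d := d) (L := L) (suRep N) β)) 0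
          + 2 * ∑' t, autocov (cmORSweep sched ∘ₖ metropolisSweep (sunMetropolisKick N s)
                (fun U : GaugeConfig d L (Matrix.specialUnitaryGroup (Fin N) ℂ) => Real.exp (-β * wilsonAction (suRep N) U)) nhit Ls)
            (wilsonMeasure (d := d) (L := L) (suRep N) β) (fun y => f y - ∫ z, f z ∂(wilsonMeasure (d := d) (L := L) (suRep N) β)) (t + 1))
        / (2 * autocov (cmORSweep sched ∘ₖ metropolisSweep (sunMetropolisKick N s)
                (fun U : GaugeConfig d L (Matrix.specialUnitaryGroup (Fin N) ℂ) => Real.exp (-β * wilsonAction (suRep N) U)) nhit Ls)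
            (wilsonMeasure (d := d) (L := L) (suRep N) β) (fun y => f y - ∫ z, f z ∂(wilsonMeasure (d := d) (L := L) (suRep N) β)) 0)) := by
  haveI := isProbabilityMeasure_wilsonMeasure_suRep N (d := d) (L := L) β
  obtain ⟨hinv, mm, ε', hmm, hε0, hε1, hmin⟩ :=
    wilson_sunMetropolis_orSweep_certificate N s (d := d) hL β hn hLs sched
  exact GeneralNCMC.chain_tauIntWindow_tendstoInMeasure_of_nHit μ₀ hinv hε0.ne' hmin hmm hf hC hvar hW hW3

/-- **FOR AN EVENT OF `'metro' + n_or × 'or'`, THE PRINTED `τ̂` CONVERGES TO THE FITNESS `τ_int`** (`0 < π(A) < 1`, every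
start, `W_N → ∞`, `W_N³/N → 0`). -/
theorem wilson_sunMetropolis_orSweep_tauIntWindow_indicator_tendstoInMeasure [NeZero L] (hL : 2 ≤ L) (β : ℝ) {nhit : ℕ}
    (hn : 1 ≤ nhit) {Ls : List (Edge d L)} (hLs : ∀ e, e ∈ Ls) (sched : List (Edge d L × (Fin N ≃ Fin 2 ⊕ m)))
    [IsMarkovKernel (metropolisSweep (sunMetropolisKick N s)
                (fun U : GaugeConfig d L (Matrix.specialUnitaryGroup (Fin N) ℂ) => Real.exp (-β * wilsonAction (suRep N) U)) nhit Ls)]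
    {A : Set (GaugeConfig d L (Matrix.specialUnitaryGroup (Fin N) ℂ))} (hA : MeasurableSet A)
    (h0 : 0 < (wilsonMeasure (d := d) (L := L) (suRep N) β).real A) (h1 : (wilsonMeasure (d := d) (L := L) (suRep N) β).real A < 1)
    (μ₀ : Measure (GaugeConfig d L (Matrix.specialUnitaryGroup (Fin N) ℂ))) [IsProbabilityMeasure μ₀]
    {W : ℕ → ℕ} (hW : Tendsto W atTop atTop) (hW3 : Tendsto (fun n => (W n : ℝ) ^ 3 / n) atTop (nhds 0)) :
    TendstoInMeasure (Kernel.trajMeasure (X := fun _ : ℕ => GaugeConfig d L (Matrix.specialUnitaryGroup (Fin N) ℂ)) μ₀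
              (fun n : ℕ => (cmORSweep sched ∘ₖ metropolisSweep (sunMetropolisKick N s)
                (fun U : GaugeConfig d L (Matrix.specialUnitaryGroup (Fin N) ℂ) => Real.exp (-β * wilsonAction (suRep N) U)) nhit Ls).comap
                (fun h : (i : ↥(Finset.Iic n)) → GaugeConfig d L (Matrix.specialUnitaryGroup (Fin N) ℂ) =>
                  h ⟨n, Finset.mem_Iic.2 le_rfl⟩) (measurable_pi_apply _)))
      (fun (n : ℕ) (x : ℕ → GaugeConfig d L (Matrix.specialUnitaryGroup (Fin N) ℂ)) =>
        tauIntWindow (rhoHat (fun i => A.indicator (1 : GaugeConfig d L (Matrix.specialUnitaryGroup (Fin N) ℂ) → ℝ) (x i)) n) (W n))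
      atTop (fun _ => tauInt (setACF (cmORSweep sched ∘ₖ metropolisSweep (sunMetropolisKick N s)
                (fun U : GaugeConfig d L (Matrix.specialUnitaryGroup (Fin N) ℂ) => Real.exp (-β * wilsonAction (suRep N) U)) nhit Ls)
            (wilsonMeasure (d := d) (L := L) (suRep N) β) A)) := by
  haveI := isProbabilityMeasure_wilsonMeasure_suRep N (d := d) (L := L) β
  obtain ⟨hinv, mm, ε', hmm, hε0, hε1, hmin⟩ :=
    wilson_sunMetropolis_orSweep_certificate N s (d := d) hL β hn hLs sched
  exact GeneralNCMC.chain_tauIntWindow_indicator_tendstoInMeasure_of_nHit μ₀ hinv hε0.ne' hmin hmm hA h0 h1 hW hW3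

end MetroOR

/-! ## §5 `'hb'` (Cabibbo–Marinari heat-bath sweep) `+ n_or × 'or'` -/

section CMOR

variable (N : ℕ) [NeZero N] {d L : ℕ} {m : Type*} [Fintype m] [DecidableEq m]

/-- **THE PRINTED `τ̂_int,W` OF `'hb' + n_or × 'or'` IS CONSISTENT, FROM EVERY START** (`L ≥ 2`, the subgroup frames in
lexicographic order or its reverse, the link list visits every link, any OR schedule; `Var_π f > 0`, `W_N → ∞`,
`W_N³/N → 0`). -/
theorem wilson_cmSweep_orSweep_tauIntWindow_tendstoInMeasure [NeZero L] (hL : 2 ≤ L) (β : ℝ) (frames : List (Fin N ≃ Fin 2 ⊕ m))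
    (hlex : frames.map pairOf = lexPairs (Finset.univ.sort (· ≤ ·) : List (Fin N)) ∨
      frames.map pairOf = (lexPairs (Finset.univ.sort (· ≤ ·) : List (Fin N))).reverse)
    {links : List (Edge d L)} (hl : ∀ e, e ∈ links) (sched : List (Edge d L × (Fin N ≃ Fin 2 ⊕ m)))
    [IsMarkovKernel (latSweep (gibbsDensity fun U : GaugeConfig d L (Matrix.specialUnitaryGroup (Fin N) ℂ) => β * wilsonAction (suRep N) U) frames links)]
    {f : GaugeConfig d L (Matrix.specialUnitaryGroup (Fin N) ℂ) → ℝ} (hf : Measurable f) {C : ℝ} (hC : ∀ U, |f U| ≤ C)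
    (hvar : 0 < autocov (cmORSweep sched ∘ₖ
                latSweep (gibbsDensity fun U : GaugeConfig d L (Matrix.specialUnitaryGroup (Fin N) ℂ) => β * wilsonAction (suRep N) U) frames links)
        (wilsonMeasure (d := d) (L := L) (suRep N) β) (fun y => f y - ∫ z, f z ∂(wilsonMeasure (d := d) (L := L) (suRep N) β)) 0)
    (μ₀ : Measure (GaugeConfig d L (Matrix.specialUnitaryGroup (Fin N) ℂ))) [IsProbabilityMeasure μ₀]
    {W : ℕ → ℕ} (hW : Tendsto W atTop atTop) (hW3 : Tendsto (fun n => (W n : ℝ) ^ 3 / n) atTop (nhds 0)) :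
    TendstoInMeasure (Kernel.trajMeasure (X := fun _ : ℕ => GaugeConfig d L (Matrix.specialUnitaryGroup (Fin N) ℂ)) μ₀
              (fun n : ℕ => (cmORSweep sched ∘ₖ
                latSweep (gibbsDensity fun U : GaugeConfig d L (Matrix.specialUnitaryGroup (Fin N) ℂ) => β * wilsonAction (suRep N) U) frames links).comap
                (fun h : (i : ↥(Finset.Iic n)) → GaugeConfig d L (Matrix.specialUnitaryGroup (Fin N) ℂ) =>
                  h ⟨n, Finset.mem_Iic.2 le_rfl⟩) (measurable_pi_apply _)))
      (fun (n : ℕ) (x : ℕ → GaugeConfig d L (Matrix.specialUnitaryGroup (Fin N) ℂ)) =>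
        tauIntWindow (rhoHat (fun i => f (x i)) n) (W n))
      atTop (fun _ =>
        (autocov (cmORSweep sched ∘ₖ
                latSweep (gibbsDensity fun U : GaugeConfig d L (Matrix.specialUnitaryGroup (Fin N) ℂ) => β * wilsonAction (suRep N) U) frames links)
            (wilsonMeasure (d := d) (L := L) (suRep N) β) (fun y => f y - ∫ z, f z ∂(wilsonMeasure (d := d) (L := L) (suRep N) β)) 0
          + 2 * ∑' t, autocov (cmORSweep sched ∘ₖ
                latSweep (gibbsDensity fun U : GaugeConfig d L (Matrix.specialUnitaryGroup (Fin N) ℂ) => β * wilsonAction (suRep N) U) frames links)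
            (wilsonMeasure (d := d) (L := L) (suRep N) β) (fun y => f y - ∫ z, f z ∂(wilsonMeasure (d := d) (L := L) (suRep N) β)) (t + 1))
        / (2 * autocov (cmORSweep sched ∘ₖ
                latSweep (gibbsDensity fun U : GaugeConfig d L (Matrix.specialUnitaryGroup (Fin N) ℂ) => β * wilsonAction (suRep N) U) frames links)
            (wilsonMeasure (d := d) (L := L) (suRep N) β) (fun y => f y - ∫ z, f z ∂(wilsonMeasure (d := d) (L := L) (suRep N) β)) 0)) := by
  haveI : IsProbabilityMeasure (wilsonMeasure (d := d) (L := L) (suRep N) β) := isProbabilityMeasure_wilsonMeasure _ continuous_suRep β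
  obtain ⟨hinv, ε', hε0, hε1, hmin⟩ := wilson_cmSweep_orSweep_certificate N (d := d) hL β frames hlex hl sched
  exact GeneralNCMC.chain_tauIntWindow_tendstoInMeasure_of_nHit μ₀ hinv hε0.ne' hmin Nat.one_pos hf hC hvar hW hW3

/-- **FOR AN EVENT OF `'hb' + n_or × 'or'`, THE PRINTED `τ̂` CONVERGES TO THE FITNESS `τ_int`** (`0 < π(A) < 1`, every
start, `W_N → ∞`, `W_N³/N → 0`). -/
theorem wilson_cmSweep_orSweep_tauIntWindow_indicator_tendstoInMeasure [NeZero L] (hL : 2 ≤ L) (β : ℝ)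
    (frames : List (Fin N ≃ Fin 2 ⊕ m))
    (hlex : frames.map pairOf = lexPairs (Finset.univ.sort (· ≤ ·) : List (Fin N)) ∨
      frames.map pairOf = (lexPairs (Finset.univ.sort (· ≤ ·) : List (Fin N))).reverse)
    {links : List (Edge d L)} (hl : ∀ e, e ∈ links) (sched : List (Edge d L × (Fin N ≃ Fin 2 ⊕ m)))
    [IsMarkovKernel (latSweep (gibbsDensity fun U : GaugeConfig d L (Matrix.specialUnitaryGroup (Fin N) ℂ) => β * wilsonAction (suRep N) U) frames links)]
    {A : Set (GaugeConfig d L (Matrix.specialUnitaryGroup (Fin N) ℂ))} (hA : MeasurableSet A)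
    (h0 : 0 < (wilsonMeasure (d := d) (L := L) (suRep N) β).real A) (h1 : (wilsonMeasure (d := d) (L := L) (suRep N) β).real A < 1)
    (μ₀ : Measure (GaugeConfig d L (Matrix.specialUnitaryGroup (Fin N) ℂ))) [IsProbabilityMeasure μ₀]
    {W : ℕ → ℕ} (hW : Tendsto W atTop atTop) (hW3 : Tendsto (fun n => (W n : ℝ) ^ 3 / n) atTop (nhds 0)) :
    TendstoInMeasure (Kernel.trajMeasure (X := fun _ : ℕ => GaugeConfig d L (Matrix.specialUnitaryGroup (Fin N) ℂ)) μ₀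
              (fun n : ℕ => (cmORSweep sched ∘ₖ
                latSweep (gibbsDensity fun U : GaugeConfig d L (Matrix.specialUnitaryGroup (Fin N) ℂ) => β * wilsonAction (suRep N) U) frames links).comap
                (fun h : (i : ↥(Finset.Iic n)) → GaugeConfig d L (Matrix.specialUnitaryGroup (Fin N) ℂ) =>
                  h ⟨n, Finset.mem_Iic.2 le_rfl⟩) (measurable_pi_apply _)))
      (fun (n : ℕ) (x : ℕ → GaugeConfig d L (Matrix.specialUnitaryGroup (Fin N) ℂ)) =>
        tauIntWindow (rhoHat (fun i => A.indicator (1 : GaugeConfig d L (Matrix.specialUnitaryGroup (Fin N) ℂ) → ℝ) (x i)) n) (W n))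
      atTop (fun _ => tauInt (setACF (cmORSweep sched ∘ₖ
                latSweep (gibbsDensity fun U : GaugeConfig d L (Matrix.specialUnitaryGroup (Fin N) ℂ) => β * wilsonAction (suRep N) U) frames links)
            (wilsonMeasure (d := d) (L := L) (suRep N) β) A)) := by
  haveI : IsProbabilityMeasure (wilsonMeasure (d := d) (L := L) (suRep N) β) := isProbabilityMeasure_wilsonMeasure _ continuous_suRep β
  obtain ⟨hinv, ε', hε0, hε1, hmin⟩ := wilson_cmSweep_orSweep_certificate N (d := d) hL β frames hlex hl sched
  exact GeneralNCMC.chain_tauIntWindow_indicator_tendstoInMeasure_of_nHit μ₀ hinv hε0.ne' hmin Nat.one_pos hA h0 h1 hW hW3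

end CMOR

end Summit.Ventures.LatticeQCDFlow.Exactness

end
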